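import Literature.MathematicalPhysics.QuantumFieldTheory.Balaban1983to89.B13OpsYPencilLetters

/-!
# `Balaban1983to89.B13OpsYPencilTransport` — T. Bałaban, *Propagators for lattice gauge theories in a background field*, Commun. Math. Phys. **99** (1985)
# 389–434 [Balaban1985BackgroundPropagators], (3.3) p. 390–391 (`U(x,x′) = U(b₁)⋯U(bₙ)` along a contour), (3.5) p. 391 (reversed bonds), (3.12)–(3.13)
# p. 392, (3.14) p. 393 and (3.19), (3.21) pp. 393–394 (the covariant averagings `Q(U)`, `Q′(U)`: «R(U(Γ^{(j)}_{y,x}))», «Γ_{y,x} a shortest contour»), (3.40) p. 397, p. 396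
# («U′ = exp iηA′»), Thm 3.4 p. 400 («extend to U′U as analytic functions of A′»), (3.108) p. 416; *Averaging operations for lattice gauge theories*, Commun.
# Math. Phys. **98** (1985) 17–51 [Balaban1985Averaging] (52)–(55) pp. 27–28; [Balaban1988RG2Cluster] (2.5) p. 12, p. 15: ★★ NODE 00's GENUINE PARALLEL
# TRANSPORTERS — the straight lines `parFwdV ∕ parBwdV`, the taxicab transporter `parTaxiV = U(Γ_{x,x′})` and the letters of record `parBY ∕ parSY`
# (`Node00/OpsYTransport`) — ALONG pv27's GROUP PENCIL `A′ ↦ prodCfg U₀ η A′ = e^{iηA′}U₀`: values and inverses HOLOMORPHIC in `A′` on every chart ball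
# and BOUNDED BY `Kη^{|x − x′|₁}` (`Kη = K₀e^{|η|R}`, `|x − x′|₁ = Site.tdist x x′` the taxicab length) — the transporter facts that make NODE 00's
# covariant averagings `QY ∕ QsY ∕ QpY ∕ QpsY` at the letters of record readable by `B13TransportedLiftLetters` along the pencil.

statement-level complex analysis ([folklore]: products of holomorphic bounded unit-valued letters, induction along a contour) AT NODE 00's `rfl`-level
definitions (`parFwdV parBwdV taxiLegV taxiRun parTaxiV parBY parSY`, consumed BY NAME with their own bookkeeping lemmas `parFwdV_succ ∕ parBwdV_succ ∕
taxiLegV_fst_apply ∕ taxiRun_fst_apply`) over pv27's pencil (`prodCfg`, `val_prodCfg`) and `B13TransportedLiftLetters` §4; kernel-checked; THEOREMS ONLY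
(no `def`, no `structure`, no instance, no notation); NOTHING of NODE 00's ∕ pv27's is modified; nothing here is a claim about the Yang–Mills mass gap;
no node is discharged; count-neutral.

WHY THIS FILE (cell `pub-ymgap`, HUMAN RULING D-0062 ∕ D-0149, Track A node N10 = [B13]; seat `pub-ymgap-dag-n10-c` g14, INTENT-5; census v16 item 1).
Modules 69–71 of the seat read the four differential letters and the Hessian of NODE 00 along the pencil; the four AVERAGING letters `QY ∕ QsY ∕ QpY ∕ QpsY`
((3.12)–(3.14), (3.21)) transport along the member's CONTOUR transporters `parB ∕ parS`, which at the letters of record (`Node00.lettersYOfRecord`, via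
`CovLettersY.withTransport`) are the GENUINE taxicab transporters `parBY ∕ parSY` of `Node00/OpsYTransport` — words of configuration values along a
shortest lattice contour.  THIS FILE proves, on any torus `P` and then at an index `i`, that along the pencil every such transporter (and its inverse) is
holomorphic in `A′` and bounded by `Kη` to the LENGTH OF ITS CONTOUR — for the taxicab transporter exactly `Kη^{Site.tdist x x′}` (each leg the shorter
way round, [B9] (3.40)) —, i.e. the four facts `B13TransportedLiftLetters` §2–§3 consume for the transporter assignments `qT ∕ qpT` of the averaging
letters (successor module: their coordinates, as 69 §3 did for `gradY ∕ divY ∕ curlY ∕ coCurlY`).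

WHAT THIS FILE PROVES (all `theorem`s; `𝔸` NODE 00's complete normed `ℂ`-algebra, `‖1‖ = 1` for the bounds).
* §0 THE PENCIL ON A GENERAL TORUS `P` (chart `Fin P.d → Site P 0 → 𝔸`): `exists_pencil_prodCfgV` (reading `A′ ↦ iη·A′_μ(x)`, norm `≤ |η|`),
  `differentiableOn_prodCfgV_apply ∕ _inv_apply`, `norm_prodCfgV_apply_le ∕ _inv_apply_le` (`≤ Kη`) — module 69 §0 verbatim on an arbitrary `Params`
  (69 states them on the member torus `PV …`).
* §1 STRAIGHT LINES: `val_inv_parFwdV_succ ∕ val_inv_parBwdV_succ` (the inverse of one more bond), `differentiableOn_parFwdV_prodCfg ∕ _inv_prodCfg`,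
  `norm_parFwdV_prodCfg_le ∕ _inv_prodCfg_le` (`≤ Kηⁿ` for `n` bonds), and the same four for `parBwdV` — induction on the contour.
* §2 LEGS AND RUNS (algebra, any configuration): `taxiLegV_snd_mul` ∕ `taxiLegV_fst_eq` (a leg multiplies the accumulated transporter on the right by
  the leg's own transporter and moves the point independently of both), `taxiRun_snd_mul` ∕ `taxiRun_fst_eq` (the same for runs).
* §3 ★ ALONG THE PENCIL: `differentiableOn_taxiLegV_prodCfg ∕ _inv_`, `norm_taxiLegV_prodCfg_le ∕ _inv_` (one leg: `≤ Kη^{min(fwd, bwd)}`),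
  `differentiableOn_taxiRun_prodCfg ∕ _inv_`, ★★ `differentiableOn_parTaxiV_prodCfg ∕ _inv_prodCfg` (`A′ ↦ U(Γ_{x,x′})` at `e^{iηA′}U₀` and its inverse
  are holomorphic on every ball), ★★ `norm_parTaxiV_prodCfg_le ∕ _inv_prodCfg_le` (`≤ Kη^{Site.tdist x x′}` — the contour has exactly `|x − x′|₁` bonds).
* §4 AT AN INDEX: `differentiableOn_parBY_prodCfg ∕ _inv_`, `norm_parBY_prodCfg_le ∕ _inv_` (`parBY i (prodCfg U₀ η A′) s s′`, `≤ Kη^{tdist s s′}`),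
  `differentiableOn_parSY_prodCfg ∕ _inv_`, `norm_parSY_prodCfg_le ∕ _inv_` (box-chart sites through `boxEquiv`).
HONEST FRAMING: NODE 00's DEFINITIONS read along pv27's DEFINITION of the pencil; inputs are numerals (`K₀`, `R`); the word-length bound is print's own
(a transport along `n` bonds of norm `≤ Kη` each); nothing of Bałaban's asserted; N06 ∕ N10 NOT discharged; K1⁷ NOT closed; counts unmoved (typed 28∕28 ·
discharged 5∕27); no `sorry`, no new named fact; standard axioms; one finite 𝕋⁴ programme at fixed ε, Bałaban AS PRINTED; the YM mass gap (Clay) is NOT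
proved by any of this — R4 closes the conditional finite-𝕋⁴ rung `BalabanLadder.UV` only; nothing continuum ∕ ℝ⁴ ∕ OS.

References: T. Bałaban, CMP 99 (1985) 389–434 [Balaban1985BackgroundPropagators] (3.3) pp.390–391, (3.5) p.391, (3.12)–(3.13) p.392, (3.14) p.393, (3.19), (3.21) pp.393–394,
(3.40) p.397, Thm 3.4 p.400, (3.108) p.416; CMP 98 (1985) 17–51 [Balaban1985Averaging] (52)–(55) pp.27–28; CMP 116 (1988) 1–22 [Balaban1988RG2Cluster] (2.5)
p.12, p.15.
────────────────────────────────────────────────────────────────────────────────────────────────────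
v1.0.1 (docstring-only; declarations byte-identical): [B9] page locators corrected per the page owner (lit-balaban-r06 g64, 2026-08-28 03:09Z):
displays (3.12)–(3.13) are p. 392 (p. 392 ends with (3.13); p. 393 opens with (3.14) «where Q_j(U)A is a linear part of the function (3.13)»); five cite
segments and the header re-paged, nothing else touched.
-/

noncomputable section

namespace Literature.MathematicalPhysics.QuantumFieldTheory.Balaban1983to89.B13OpsYPencilTransport

open Metric Set Complex
open NormedSpace (exp)
open Literature.MathematicalPhysics.QuantumFieldTheory.Balaban1983to89
open Literature.MathematicalPhysics.QuantumFieldTheory.Balaban1983to89.B9Eq39Adjoint (prodCfg)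
open Literature.MathematicalPhysics.QuantumFieldTheory.Balaban1983to89.B9Eq369Product (val_prodCfg)
open Literature.MathematicalPhysics.QuantumFieldTheory.Balaban1983to89.B9BackgroundsKLevelV1 (CfgV1)
open Literature.MathematicalPhysics.QuantumFieldTheory.Balaban1983to89.B6GlobalChartV1 (PV boxEquiv)
open Literature.MathematicalPhysics.QuantumFieldTheory.Balaban1983to89.B6KLevelCensusIndexV1 (KIdx)
open Literature.MathematicalPhysics.QuantumFieldTheory.Balaban1983to89.Node00
  (SiteY CfgY parFwdV parBwdV parFwdV_succ parBwdV_succ taxiLegV taxiRun parTaxiV parBY parSY taxiLegV_fst_apply taxiRun_fst_apply)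
open Literature.MathematicalPhysics.QuantumFieldTheory.Balaban1983to89.B13TransportedLiftLetters
  (units_inv_eq_of_eq_exp_mul differentiableOn_pencil differentiableOn_pencil_inv norm_pencil_le norm_pencil_inv_le)

variable {𝔸 : Type} [NormedRing 𝔸] [NormedAlgebra ℂ 𝔸] [CompleteSpace 𝔸]

/-! ## §0. The pencil on a general torus `P` -/

section PencilV

variable {P : Params} (U₀ : CfgV1 P 𝔸) (η : ℝ) {Rc K₀ : ℝ}

omit [CompleteSpace 𝔸] in
/-- The evaluation `A′ ↦ c·A′_μ(x)` as a continuous linear map has norm `≤ ‖c‖` (plumbing; sup norm). [folklore] -/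
private theorem norm_smul_eval_le (c : ℂ) (μ : Fin P.d) (x : Site P 0) :
    ‖c • ((ContinuousLinearMap.proj (R := ℂ) (φ := fun _ : Site P 0 => 𝔸) x).comp
        (ContinuousLinearMap.proj (R := ℂ) (φ := fun _ : Fin P.d => Site P 0 → 𝔸) μ))‖ ≤ ‖c‖ := by
  refine ContinuousLinearMap.opNorm_le_bound _ (norm_nonneg c) fun a => ?_
  change ‖c • a μ x‖ ≤ ‖c‖ * ‖a‖
  rw [norm_smul]
  exact mul_le_mul_of_nonneg_left ((norm_le_pi_norm (a μ) x).trans (norm_le_pi_norm a μ)) (norm_nonneg c)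

/-- **THE PENCIL's READING ON A GENERAL TORUS**: `(prodCfg U₀ η A′)_μ(x) = exp(L_{μx}A′)·U₀μ(x)` with `L_{μx} : A′ ↦ iη·A′_μ(x)` of norm `≤ |η|`
(module 69's `exists_pencil_prodCfg` on an arbitrary `Params`). [cite: Balaban1985BackgroundPropagators, p.390 («U = U′U₀»), p.396, Thm 3.4 p.400] -/
theorem exists_pencil_prodCfgV :
    ∃ L : Fin P.d → Site P 0 → ((Fin P.d → Site P 0 → 𝔸) →L[ℂ] 𝔸),
      (∀ μ x, ‖L μ x‖ ≤ |η|) ∧ ∀ a μ x, (prodCfg U₀ η a μ x : 𝔸) = exp (L μ x a) * (U₀ μ x : 𝔸) := by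
  refine ⟨fun μ x => (I * η : ℂ) • ((ContinuousLinearMap.proj (R := ℂ) (φ := fun _ : Site P 0 => 𝔸) x).comp
      (ContinuousLinearMap.proj (R := ℂ) (φ := fun _ : Fin P.d => Site P 0 → 𝔸) μ)),
    fun μ x => (norm_smul_eval_le _ μ x).trans (le_of_eq ?_), fun a μ x => val_prodCfg U₀ η a μ x⟩
  rw [norm_mul, Complex.norm_I, one_mul, Complex.norm_real, Real.norm_eq_abs]

/-- `A′ ↦ (e^{iηA′}U₀)_μ(x)` is holomorphic on every ball (general torus). [cite: Balaban1985BackgroundPropagators, p.390, Thm 3.4 p.400] -/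
theorem differentiableOn_prodCfgV_apply (μ : Fin P.d) (x : Site P 0) :
    DifferentiableOn ℂ (fun a => (prodCfg U₀ η a μ x : 𝔸)) (ball (0 : Fin P.d → Site P 0 → 𝔸) Rc) := by
  obtain ⟨L, -, hT⟩ := exists_pencil_prodCfgV U₀ η
  exact differentiableOn_pencil L U₀ (fun a => prodCfg U₀ η a) hT μ x

/-- `A′ ↦ (e^{iηA′}U₀)_μ(x)⁻¹` is holomorphic on every ball (general torus). [cite: Balaban1985BackgroundPropagators, (3.5) p.391, Thm 3.4 p.400] -/
theorem differentiableOn_prodCfgV_inv_apply (μ : Fin P.d) (x : Site P 0) :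
    DifferentiableOn ℂ (fun a => (((prodCfg U₀ η a μ x)⁻¹ : 𝔸ˣ) : 𝔸)) (ball (0 : Fin P.d → Site P 0 → 𝔸) Rc) := by
  obtain ⟨L, -, hT⟩ := exists_pencil_prodCfgV U₀ η
  exact differentiableOn_pencil_inv L U₀ (fun a => prodCfg U₀ η a) hT μ x

variable [NormOneClass 𝔸]

/-- On `‖A′‖ < R`: `‖(e^{iηA′}U₀)_μ(x)‖ ≤ K₀e^{|η|R}` once `‖U₀μ(x)‖ ≤ K₀` (general torus). [cite: Balaban1985BackgroundPropagators, (3.35)–(3.37) p.396] -/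
theorem norm_prodCfgV_apply_le (hU : ∀ μ x, ‖(U₀ μ x : 𝔸)‖ ≤ K₀) (hRc : 0 ≤ Rc) :
    ∀ a ∈ ball (0 : Fin P.d → Site P 0 → 𝔸) Rc, ∀ μ x, ‖(prodCfg U₀ η a μ x : 𝔸)‖ ≤ K₀ * Real.exp (|η| * Rc) := by
  obtain ⟨L, hL, hT⟩ := exists_pencil_prodCfgV U₀ η
  exact norm_pencil_le L U₀ (fun a => prodCfg U₀ η a) hT hL hU hRc

/-- On `‖A′‖ < R`: `‖(e^{iηA′}U₀)_μ(x)⁻¹‖ ≤ K₀e^{|η|R}` once `‖U₀μ(x)⁻¹‖ ≤ K₀` (general torus). [cite: Balaban1985BackgroundPropagators, (3.5) p.391, (3.35)–(3.37) p.396] -/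
theorem norm_prodCfgV_inv_apply_le (hUi : ∀ μ x, ‖(((U₀ μ x)⁻¹ : 𝔸ˣ) : 𝔸)‖ ≤ K₀) (hRc : 0 ≤ Rc) :
    ∀ a ∈ ball (0 : Fin P.d → Site P 0 → 𝔸) Rc, ∀ μ x, ‖(((prodCfg U₀ η a μ x)⁻¹ : 𝔸ˣ) : 𝔸)‖ ≤ K₀ * Real.exp (|η| * Rc) := by
  obtain ⟨L, hL, hT⟩ := exists_pencil_prodCfgV U₀ η
  exact norm_pencil_inv_le L U₀ (fun a => prodCfg U₀ η a) hT hL hUi hRc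

end PencilV

/-! ## §1. Straight-line transporters along the pencil -/

section Straight

variable {P : Params} (U₀ : CfgV1 P 𝔸) (η : ℝ) {Rc K₀ : ℝ}

omit [NormedAlgebra ℂ 𝔸] [CompleteSpace 𝔸] in
/-- the inverse of one more forward bond: `(U_μ(x)·U(Γ′))⁻¹ = U(Γ′)⁻¹·U_μ(x)⁻¹`. [cite: Balaban1985BackgroundPropagators, (3.3), (3.5) p.391] -/
theorem val_inv_parFwdV_succ [NormedAlgebra ℂ 𝔸] [CompleteSpace 𝔸] (U : CfgV1 P 𝔸) (μ : Fin P.d) (n : ℕ) (x : Site P 0) :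
    (((parFwdV U μ (n + 1) x)⁻¹ : 𝔸ˣ) : 𝔸) = (((parFwdV U μ n (x.shift μ))⁻¹ : 𝔸ˣ) : 𝔸) * (((U μ x)⁻¹ : 𝔸ˣ) : 𝔸) := by
  rw [parFwdV_succ, mul_inv_rev, Units.val_mul]

omit [NormedAlgebra ℂ 𝔸] [CompleteSpace 𝔸] in
/-- the inverse of one more backward bond. [cite: Balaban1985BackgroundPropagators, (3.3), (3.5) p.391] -/
theorem val_inv_parBwdV_succ [NormedAlgebra ℂ 𝔸] [CompleteSpace 𝔸] (U : CfgV1 P 𝔸) (μ : Fin P.d) (n : ℕ) (x : Site P 0) :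
    (((parBwdV U μ (n + 1) x)⁻¹ : 𝔸ˣ) : 𝔸) = (((parBwdV U μ n (x.unshift μ))⁻¹ : 𝔸ˣ) : 𝔸) * (U μ (x.unshift μ) : 𝔸) := by
  rw [parBwdV_succ, mul_inv_rev, inv_inv, Units.val_mul]

/-- `A′ ↦ U(Γ)` along a FORWARD straight contour of `n` bonds at `U = e^{iηA′}U₀` is holomorphic on every ball.
[cite: Balaban1985BackgroundPropagators, (3.3) p.391, Thm 3.4 p.400] -/
theorem differentiableOn_parFwdV_prodCfg (μ : Fin P.d) (n : ℕ) :
    ∀ x : Site P 0, DifferentiableOn ℂ (fun a => (parFwdV (prodCfg U₀ η a) μ n x : 𝔸)) (ball (0 : Fin P.d → Site P 0 → 𝔸) Rc) := by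
  induction n with
  | zero => intro x; simp only [Node00.parFwdV_zero, Units.val_one]; exact differentiableOn_const _
  | succ n ih =>
    intro x
    simp only [parFwdV_succ, Units.val_mul]
    exact (differentiableOn_prodCfgV_apply U₀ η μ x).mul (ih (x.shift μ))

/-- … and so is its inverse. [cite: Balaban1985BackgroundPropagators, (3.3), (3.5) p.391, Thm 3.4 p.400] -/
theorem differentiableOn_parFwdV_inv_prodCfg (μ : Fin P.d) (n : ℕ) :
    ∀ x : Site P 0, DifferentiableOn ℂ (fun a => (((parFwdV (prodCfg U₀ η a) μ n x)⁻¹ : 𝔸ˣ) : 𝔸)) (ball (0 : Fin P.d → Site P 0 → 𝔸) Rc) := by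
  induction n with
  | zero => intro x; simp only [Node00.parFwdV_zero, inv_one, Units.val_one]; exact differentiableOn_const _
  | succ n ih =>
    intro x
    simp only [val_inv_parFwdV_succ]
    exact (ih (x.shift μ)).mul (differentiableOn_prodCfgV_inv_apply U₀ η μ x)

/-- `A′ ↦ U(Γ)` along a BACKWARD straight contour of `n` bonds at `U = e^{iηA′}U₀` is holomorphic on every ball.
[cite: Balaban1985BackgroundPropagators, (3.3), (3.5) p.391, Thm 3.4 p.400] -/
theorem differentiableOn_parBwdV_prodCfg (μ : Fin P.d) (n : ℕ) :
    ∀ x : Site P 0, DifferentiableOn ℂ (fun a => (parBwdV (prodCfg U₀ η a) μ n x : 𝔸)) (ball (0 : Fin P.d → Site P 0 → 𝔸) Rc) := by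
  induction n with
  | zero => intro x; simp only [Node00.parBwdV_zero, Units.val_one]; exact differentiableOn_const _
  | succ n ih =>
    intro x
    simp only [parBwdV_succ, Units.val_mul]
    exact (differentiableOn_prodCfgV_inv_apply U₀ η μ _).mul (ih (x.unshift μ))

/-- … and so is its inverse. [cite: Balaban1985BackgroundPropagators, (3.3), (3.5) p.391, Thm 3.4 p.400] -/
theorem differentiableOn_parBwdV_inv_prodCfg (μ : Fin P.d) (n : ℕ) :
    ∀ x : Site P 0, DifferentiableOn ℂ (fun a => (((parBwdV (prodCfg U₀ η a) μ n x)⁻¹ : 𝔸ˣ) : 𝔸)) (ball (0 : Fin P.d → Site P 0 → 𝔸) Rc) := by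
  induction n with
  | zero => intro x; simp only [Node00.parBwdV_zero, inv_one, Units.val_one]; exact differentiableOn_const _
  | succ n ih =>
    intro x
    simp only [val_inv_parBwdV_succ]
    exact (ih (x.unshift μ)).mul (differentiableOn_prodCfgV_apply U₀ η μ _)

variable [NormOneClass 𝔸]

omit [NormedAlgebra ℂ 𝔸] [CompleteSpace 𝔸] [NormOneClass 𝔸] in
/-- `‖a·b‖ ≤ K·Kⁿ = K^{n+1}` from `‖a‖ ≤ K`, `‖b‖ ≤ Kⁿ` (plumbing). [folklore] -/
private theorem norm_mul_le_pow_succ {a b : 𝔸} {K : ℝ} {n : ℕ} (ha : ‖a‖ ≤ K) (hb : ‖b‖ ≤ K ^ n) : ‖a * b‖ ≤ K ^ (n + 1) := by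
  have h0 : 0 ≤ K := (norm_nonneg _).trans ha
  rw [pow_succ']
  exact (norm_mul_le _ _).trans (mul_le_mul ha hb (norm_nonneg _) h0)

omit [NormedAlgebra ℂ 𝔸] [CompleteSpace 𝔸] [NormOneClass 𝔸] in
/-- `‖b·a‖ ≤ Kⁿ·K = K^{n+1}` from `‖b‖ ≤ Kⁿ`, `‖a‖ ≤ K` (plumbing). [folklore] -/
private theorem norm_mul_le_pow_succ' {a b : 𝔸} {K : ℝ} {n : ℕ} (hb : ‖b‖ ≤ K ^ n) (ha : ‖a‖ ≤ K) : ‖b * a‖ ≤ K ^ (n + 1) := by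
  have h0 : 0 ≤ K := (norm_nonneg _).trans ha
  rw [pow_succ]
  exact (norm_mul_le _ _).trans (mul_le_mul hb ha (norm_nonneg _) (pow_nonneg h0 n))

/-- On `‖A′‖ < R`: `‖U(Γ)‖ ≤ Kηⁿ` for a forward contour of `n` bonds, `Kη = K₀e^{|η|R}`, once `‖U₀(b)‖ ≤ K₀`.
[cite: Balaban1985BackgroundPropagators, (3.3) p.391, (3.35)–(3.37) p.396, Thm 3.4 p.400] -/
theorem norm_parFwdV_prodCfg_le (hU : ∀ μ x, ‖(U₀ μ x : 𝔸)‖ ≤ K₀) (hRc : 0 ≤ Rc) {a : Fin P.d → Site P 0 → 𝔸} (ha : a ∈ ball 0 Rc)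
    (μ : Fin P.d) (n : ℕ) : ∀ x : Site P 0, ‖(parFwdV (prodCfg U₀ η a) μ n x : 𝔸)‖ ≤ (K₀ * Real.exp (|η| * Rc)) ^ n := by
  induction n with
  | zero => intro x; simp
  | succ n ih =>
    intro x
    rw [parFwdV_succ, Units.val_mul]
    exact norm_mul_le_pow_succ (norm_prodCfgV_apply_le U₀ η hU hRc a ha μ x) (ih (x.shift μ))

/-- On `‖A′‖ < R`: `‖U(Γ)⁻¹‖ ≤ Kηⁿ` for a forward contour of `n` bonds once `‖U₀(b)⁻¹‖ ≤ K₀`.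
[cite: Balaban1985BackgroundPropagators, (3.3), (3.5) p.391, (3.35)–(3.37) p.396] -/
theorem norm_parFwdV_inv_prodCfg_le (hUi : ∀ μ x, ‖(((U₀ μ x)⁻¹ : 𝔸ˣ) : 𝔸)‖ ≤ K₀) (hRc : 0 ≤ Rc) {a : Fin P.d → Site P 0 → 𝔸}
    (ha : a ∈ ball 0 Rc) (μ : Fin P.d) (n : ℕ) :
    ∀ x : Site P 0, ‖(((parFwdV (prodCfg U₀ η a) μ n x)⁻¹ : 𝔸ˣ) : 𝔸)‖ ≤ (K₀ * Real.exp (|η| * Rc)) ^ n := by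
  induction n with
  | zero => intro x; simp
  | succ n ih =>
    intro x
    rw [val_inv_parFwdV_succ]
    exact norm_mul_le_pow_succ' (ih (x.shift μ)) (norm_prodCfgV_inv_apply_le U₀ η hUi hRc a ha μ x)

/-- On `‖A′‖ < R`: `‖U(Γ)‖ ≤ Kηⁿ` for a backward contour of `n` bonds once `‖U₀(b)⁻¹‖ ≤ K₀`.
[cite: Balaban1985BackgroundPropagators, (3.3), (3.5) p.391, (3.35)–(3.37) p.396] -/
theorem norm_parBwdV_prodCfg_le (hUi : ∀ μ x, ‖(((U₀ μ x)⁻¹ : 𝔸ˣ) : 𝔸)‖ ≤ K₀) (hRc : 0 ≤ Rc) {a : Fin P.d → Site P 0 → 𝔸}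
    (ha : a ∈ ball 0 Rc) (μ : Fin P.d) (n : ℕ) : ∀ x : Site P 0, ‖(parBwdV (prodCfg U₀ η a) μ n x : 𝔸)‖ ≤ (K₀ * Real.exp (|η| * Rc)) ^ n := by
  induction n with
  | zero => intro x; simp
  | succ n ih =>
    intro x
    rw [parBwdV_succ, Units.val_mul]
    exact norm_mul_le_pow_succ (norm_prodCfgV_inv_apply_le U₀ η hUi hRc a ha μ _) (ih (x.unshift μ))

/-- On `‖A′‖ < R`: `‖U(Γ)⁻¹‖ ≤ Kηⁿ` for a backward contour of `n` bonds once `‖U₀(b)‖ ≤ K₀`.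
[cite: Balaban1985BackgroundPropagators, (3.3), (3.5) p.391, (3.35)–(3.37) p.396] -/
theorem norm_parBwdV_inv_prodCfg_le (hU : ∀ μ x, ‖(U₀ μ x : 𝔸)‖ ≤ K₀) (hRc : 0 ≤ Rc) {a : Fin P.d → Site P 0 → 𝔸} (ha : a ∈ ball 0 Rc)
    (μ : Fin P.d) (n : ℕ) : ∀ x : Site P 0, ‖(((parBwdV (prodCfg U₀ η a) μ n x)⁻¹ : 𝔸ˣ) : 𝔸)‖ ≤ (K₀ * Real.exp (|η| * Rc)) ^ n := by
  induction n with
  | zero => intro x; simp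
  | succ n ih =>
    intro x
    rw [val_inv_parBwdV_succ]
    exact norm_mul_le_pow_succ' (ih (x.unshift μ)) (norm_prodCfgV_apply_le U₀ η hU hRc a ha μ _)

end Straight

/-! ## §2. Legs and runs: the accumulated transporter multiplies on the right; the point moves independently (algebra, any `U`) -/

section Algebra

variable {P : Params}

omit [NormedAlgebra ℂ 𝔸] [CompleteSpace 𝔸] in
/-- A leg from the state `(y, V)` multiplies `V` on the right by the leg's own transporter (the one accumulated from `(y, 1)`).
[cite: Balaban1985BackgroundPropagators, (3.3) p.391 («U(x,x′) = U(b₁)U(b₂)⋯U(bₙ)»), (3.40) p.397] -/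
theorem taxiLegV_snd_mul [NormedAlgebra ℂ 𝔸] [CompleteSpace 𝔸] (U : CfgV1 P 𝔸) (x' y : Site P 0) (V : 𝔸ˣ) (μ : Fin P.d) :
    (taxiLegV U x' (y, V) μ).2 = V * (taxiLegV U x' (y, 1) μ).2 := by
  unfold taxiLegV
  split_ifs <;> simp

omit [NormedAlgebra ℂ 𝔸] [CompleteSpace 𝔸] in
/-- A leg moves the point independently of the accumulated transporter and of the configuration.
[cite: Balaban1985BackgroundPropagators, (3.40) p.397, bookkeeping] -/
theorem taxiLegV_fst_eq [NormedAlgebra ℂ 𝔸] [CompleteSpace 𝔸] (U U' : CfgV1 P 𝔸) (x' y : Site P 0) (V V' : 𝔸ˣ) (μ : Fin P.d) :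
    (taxiLegV U x' (y, V) μ).1 = (taxiLegV U' x' (y, V') μ).1 := by
  funext ν
  rw [taxiLegV_fst_apply, taxiLegV_fst_apply]

omit [NormedAlgebra ℂ 𝔸] [CompleteSpace 𝔸] in
/-- A run from `(y, V)` multiplies `V` on the right by the run's own transporter from `(y, 1)`, and ends where the run from `(y, 1)` under ANY
configuration ends. [cite: Balaban1985BackgroundPropagators, (3.3) p.391, (3.40) p.397] -/
theorem taxiRun_snd_mul_and_fst_eq [NormedAlgebra ℂ 𝔸] [CompleteSpace 𝔸] (U U' : CfgV1 P 𝔸) (x' : Site P 0) (l : List (Fin P.d)) :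
    ∀ (y : Site P 0) (V V' : 𝔸ˣ), (taxiRun U x' l (y, V)).2 = V * (taxiRun U x' l (y, 1)).2 ∧
      (taxiRun U x' l (y, V)).1 = (taxiRun U' x' l (y, V')).1 := by
  induction l with
  | nil => intro y V V'; simp [taxiRun]
  | cons μ l ih =>
    intro y V V'
    simp only [taxiRun, List.foldl_cons] at ih ⊢
    have h1 : taxiLegV U x' (y, V) μ = ((taxiLegV U x' (y, 1) μ).1, V * (taxiLegV U x' (y, 1) μ).2) :=
      Prod.ext (taxiLegV_fst_eq U U x' y V 1 μ) (taxiLegV_snd_mul U x' y V μ)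
    have h1' : taxiLegV U' x' (y, V') μ = ((taxiLegV U x' (y, 1) μ).1, V' * (taxiLegV U' x' (y, 1) μ).2) :=
      Prod.ext (taxiLegV_fst_eq U' U x' y V' 1 μ) (taxiLegV_snd_mul U' x' y V' μ)
    have h2 : taxiLegV U x' (y, 1) μ = ((taxiLegV U x' (y, 1) μ).1, (taxiLegV U x' (y, 1) μ).2) := rfl
    refine ⟨?_, ?_⟩
    · rw [h1, (ih _ _ 1).1, h2, (ih (taxiLegV U x' (y, 1) μ).1 (taxiLegV U x' (y, 1) μ).2 1).1, mul_assoc]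
    · rw [h1, h1', (ih _ _ (V' * (taxiLegV U' x' (y, 1) μ).2)).2]

end Algebra

/-! ## §3. ★ Legs, runs and the taxicab transporter along the pencil -/

section Taxi

variable {P : Params} (U₀ : CfgV1 P 𝔸) (η : ℝ) {Rc K₀ : ℝ}

/-- One leg along the pencil: `A′ ↦` (the leg's transporter from `(y, 1)`) is holomorphic on every ball.
[cite: Balaban1985BackgroundPropagators, (3.40) p.397, Thm 3.4 p.400] -/
theorem differentiableOn_taxiLegV_prodCfg (x' y : Site P 0) (μ : Fin P.d) :
    DifferentiableOn ℂ (fun a => ((taxiLegV (prodCfg U₀ η a) x' (y, 1) μ).2 : 𝔸)) (ball (0 : Fin P.d → Site P 0 → 𝔸) Rc) := by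
  unfold taxiLegV
  split_ifs
  · simp only [one_mul]; exact differentiableOn_parFwdV_prodCfg U₀ η μ _ y
  · simp only [one_mul]; exact differentiableOn_parBwdV_prodCfg U₀ η μ _ y

/-- … and so is its inverse. [cite: Balaban1985BackgroundPropagators, (3.40) p.397, (3.5) p.391, Thm 3.4 p.400] -/
theorem differentiableOn_taxiLegV_inv_prodCfg (x' y : Site P 0) (μ : Fin P.d) :
    DifferentiableOn ℂ (fun a => ((((taxiLegV (prodCfg U₀ η a) x' (y, 1) μ).2)⁻¹ : 𝔸ˣ) : 𝔸)) (ball (0 : Fin P.d → Site P 0 → 𝔸) Rc) := by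
  unfold taxiLegV
  split_ifs
  · simp only [one_mul]; exact differentiableOn_parFwdV_inv_prodCfg U₀ η μ _ y
  · simp only [one_mul]; exact differentiableOn_parBwdV_inv_prodCfg U₀ η μ _ y

/-- A run along the pencil from `(y, 1)`: holomorphic on every ball (induction on the legs: the point after the first leg does not depend on `A′`,
§2, and the transporter multiplies). [cite: Balaban1985BackgroundPropagators, (3.3) p.391, (3.40) p.397, Thm 3.4 p.400] -/
theorem differentiableOn_taxiRun_prodCfg (x' : Site P 0) (l : List (Fin P.d)) :
    ∀ y : Site P 0, DifferentiableOn ℂ (fun a => ((taxiRun (prodCfg U₀ η a) x' l (y, 1)).2 : 𝔸)) (ball (0 : Fin P.d → Site P 0 → 𝔸) Rc) := by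
  induction l with
  | nil => intro y; simp only [taxiRun, List.foldl_nil, Units.val_one]; exact differentiableOn_const _
  | cons μ l ih =>
    intro y
    -- the point after the first leg (configuration-independent): read it at the background `U₀`
    have hrw : ∀ a : Fin P.d → Site P 0 → 𝔸, ((taxiRun (prodCfg U₀ η a) x' (μ :: l) (y, 1)).2 : 𝔸) =
        ((taxiLegV (prodCfg U₀ η a) x' (y, 1) μ).2 : 𝔸) * ((taxiRun (prodCfg U₀ η a) x' l ((taxiLegV U₀ x' (y, 1) μ).1, 1)).2 : 𝔸) := by
      intro a
      simp only [taxiRun, List.foldl_cons]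
      have h := taxiRun_snd_mul_and_fst_eq (prodCfg U₀ η a) U₀ x' l
      simp only [taxiRun] at h
      rw [show taxiLegV (prodCfg U₀ η a) x' (y, 1) μ = ((taxiLegV U₀ x' (y, 1) μ).1, (taxiLegV (prodCfg U₀ η a) x' (y, 1) μ).2) from
        Prod.ext (taxiLegV_fst_eq _ _ x' y 1 1 μ) rfl, (h _ _ 1).1, Units.val_mul]
    simp only [hrw]
    exact (differentiableOn_taxiLegV_prodCfg U₀ η x' y μ).mul (ih _)

/-- … and the inverse of a run along the pencil is holomorphic. [cite: Balaban1985BackgroundPropagators, (3.3), (3.5) p.391, (3.40) p.397, Thm 3.4 p.400] -/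
theorem differentiableOn_taxiRun_inv_prodCfg (x' : Site P 0) (l : List (Fin P.d)) :
    ∀ y : Site P 0, DifferentiableOn ℂ (fun a => ((((taxiRun (prodCfg U₀ η a) x' l (y, 1)).2)⁻¹ : 𝔸ˣ) : 𝔸))
      (ball (0 : Fin P.d → Site P 0 → 𝔸) Rc) := by
  induction l with
  | nil => intro y; simp only [taxiRun, List.foldl_nil, inv_one, Units.val_one]; exact differentiableOn_const _
  | cons μ l ih =>
    intro y
    have hrw : ∀ a : Fin P.d → Site P 0 → 𝔸, ((((taxiRun (prodCfg U₀ η a) x' (μ :: l) (y, 1)).2)⁻¹ : 𝔸ˣ) : 𝔸) =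
        ((((taxiRun (prodCfg U₀ η a) x' l ((taxiLegV U₀ x' (y, 1) μ).1, 1)).2)⁻¹ : 𝔸ˣ) : 𝔸) *
          ((((taxiLegV (prodCfg U₀ η a) x' (y, 1) μ).2)⁻¹ : 𝔸ˣ) : 𝔸) := by
      intro a
      simp only [taxiRun, List.foldl_cons]
      have h := taxiRun_snd_mul_and_fst_eq (prodCfg U₀ η a) U₀ x' l
      simp only [taxiRun] at h
      rw [show taxiLegV (prodCfg U₀ η a) x' (y, 1) μ = ((taxiLegV U₀ x' (y, 1) μ).1, (taxiLegV (prodCfg U₀ η a) x' (y, 1) μ).2) from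
        Prod.ext (taxiLegV_fst_eq _ _ x' y 1 1 μ) rfl, (h _ _ 1).1, mul_inv_rev, Units.val_mul]
    simp only [hrw]
    exact (ih _).mul (differentiableOn_taxiLegV_inv_prodCfg U₀ η x' y μ)

/-- ★★ **THE TAXICAB TRANSPORTER `U(Γ_{x,x′})` ALONG THE PENCIL IS HOLOMORPHIC IN `A′`** on every chart ball.
[cite: Balaban1985BackgroundPropagators, (3.3) p.391, (3.40) p.397, Thm 3.4 p.400; Balaban1985Averaging, (52)–(55) pp.27–28] -/
theorem differentiableOn_parTaxiV_prodCfg (x x' : Site P 0) :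
    DifferentiableOn ℂ (fun a => (parTaxiV (prodCfg U₀ η a) x x' : 𝔸)) (ball (0 : Fin P.d → Site P 0 → 𝔸) Rc) :=
  differentiableOn_taxiRun_prodCfg U₀ η x' _ x

/-- ★★ **… AND SO IS ITS INVERSE `U(Γ_{x,x′})⁻¹`**. [cite: Balaban1985BackgroundPropagators, (3.3), (3.5) p.391, (3.40) p.397, Thm 3.4 p.400] -/
theorem differentiableOn_parTaxiV_inv_prodCfg (x x' : Site P 0) :
    DifferentiableOn ℂ (fun a => (((parTaxiV (prodCfg U₀ η a) x x')⁻¹ : 𝔸ˣ) : 𝔸)) (ball (0 : Fin P.d → Site P 0 → 𝔸) Rc) :=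
  differentiableOn_taxiRun_inv_prodCfg U₀ η x' _ x

variable [NormOneClass 𝔸]

/-- One leg along the pencil is bounded by `Kη^{min(fwd, bwd)}` (the shorter way round, [B9] (3.40)) once `‖U₀(b)^{±1}‖ ≤ K₀`.
[cite: Balaban1985BackgroundPropagators, (3.40) p.397, (3.35)–(3.37) p.396] -/
theorem norm_taxiLegV_prodCfg_le (hU : ∀ μ x, ‖(U₀ μ x : 𝔸)‖ ≤ K₀) (hUi : ∀ μ x, ‖(((U₀ μ x)⁻¹ : 𝔸ˣ) : 𝔸)‖ ≤ K₀) (hRc : 0 ≤ Rc)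
    {a : Fin P.d → Site P 0 → 𝔸} (ha : a ∈ ball 0 Rc) (x' y : Site P 0) (μ : Fin P.d) :
    ‖((taxiLegV (prodCfg U₀ η a) x' (y, 1) μ).2 : 𝔸)‖ ≤ (K₀ * Real.exp (|η| * Rc)) ^ min (x' μ - y μ).val (y μ - x' μ).val := by
  unfold taxiLegV
  split_ifs with h
  · rw [min_eq_left h]; simp only [one_mul]; exact norm_parFwdV_prodCfg_le U₀ η hU hRc ha μ _ y
  · rw [min_eq_right (le_of_not_ge h)]; simp only [one_mul]; exact norm_parBwdV_prodCfg_le U₀ η hUi hRc ha μ _ y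

/-- … and so is its inverse. [cite: Balaban1985BackgroundPropagators, (3.40) p.397, (3.5) p.391, (3.35)–(3.37) p.396] -/
theorem norm_taxiLegV_inv_prodCfg_le (hU : ∀ μ x, ‖(U₀ μ x : 𝔸)‖ ≤ K₀) (hUi : ∀ μ x, ‖(((U₀ μ x)⁻¹ : 𝔸ˣ) : 𝔸)‖ ≤ K₀) (hRc : 0 ≤ Rc)
    {a : Fin P.d → Site P 0 → 𝔸} (ha : a ∈ ball 0 Rc) (x' y : Site P 0) (μ : Fin P.d) :
    ‖((((taxiLegV (prodCfg U₀ η a) x' (y, 1) μ).2)⁻¹ : 𝔸ˣ) : 𝔸)‖ ≤ (K₀ * Real.exp (|η| * Rc)) ^ min (x' μ - y μ).val (y μ - x' μ).val := by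
  unfold taxiLegV
  split_ifs with h
  · rw [min_eq_left h]; simp only [one_mul]; exact norm_parFwdV_inv_prodCfg_le U₀ η hUi hRc ha μ _ y
  · rw [min_eq_right (le_of_not_ge h)]; simp only [one_mul]; exact norm_parBwdV_inv_prodCfg_le U₀ η hU hRc ha μ _ y

/-- A run along the pencil over DISTINCT directions `l` from `(y, 1)` is bounded by `Kη` to the number of its bonds,
`Σ_{μ ∈ l} min((x′_μ − y_μ).val, (y_μ − x′_μ).val)` (each leg starts at a point whose `μ`-coordinate is still `y_μ`, §2 ∕ NODE 00's `taxiRun_fst_apply`).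
[cite: Balaban1985BackgroundPropagators, (3.3) p.391, (3.40) p.397, (3.35)–(3.37) p.396] -/
theorem norm_taxiRun_prodCfg_le (hU : ∀ μ x, ‖(U₀ μ x : 𝔸)‖ ≤ K₀) (hUi : ∀ μ x, ‖(((U₀ μ x)⁻¹ : 𝔸ˣ) : 𝔸)‖ ≤ K₀) (hRc : 0 ≤ Rc)
    {a : Fin P.d → Site P 0 → 𝔸} (ha : a ∈ ball 0 Rc) (x' : Site P 0) (l : List (Fin P.d)) (hl : l.Nodup) :
    ∀ y : Site P 0, ‖((taxiRun (prodCfg U₀ η a) x' l (y, 1)).2 : 𝔸)‖ ≤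
      (K₀ * Real.exp (|η| * Rc)) ^ (l.map fun μ => min (x' μ - y μ).val (y μ - x' μ).val).sum := by
  induction l with
  | nil => intro y; simp [taxiRun]
  | cons μ l ih =>
    intro y
    have hμ : μ ∉ l := (List.nodup_cons.1 hl).1
    have hl' : l.Nodup := (List.nodup_cons.1 hl).2
    -- decompose the run as in `differentiableOn_taxiRun_prodCfg`
    have h := taxiRun_snd_mul_and_fst_eq (prodCfg U₀ η a) U₀ x' l
    simp only [taxiRun] at h
    simp only [taxiRun, List.foldl_cons]
    rw [show taxiLegV (prodCfg U₀ η a) x' (y, 1) μ = ((taxiLegV U₀ x' (y, 1) μ).1, (taxiLegV (prodCfg U₀ η a) x' (y, 1) μ).2) from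
      Prod.ext (taxiLegV_fst_eq _ _ x' y 1 1 μ) rfl, (h _ _ 1).1, Units.val_mul, List.map_cons, List.sum_cons, pow_add]
    have h0 : 0 ≤ K₀ * Real.exp (|η| * Rc) := (norm_nonneg _).trans ((hU (Classical.arbitrary _) (Classical.arbitrary _)).trans
      (le_mul_of_one_le_right ((norm_nonneg _).trans (hU (Classical.arbitrary _) (Classical.arbitrary _))) (Real.one_le_exp (mul_nonneg (abs_nonneg _) hRc))))
    refine (norm_mul_le _ _).trans (mul_le_mul (norm_taxiLegV_prodCfg_le U₀ η hU hUi hRc ha x' y μ) ?_ (norm_nonneg _) (pow_nonneg h0 _))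
    -- the remaining legs start at the moved point, whose coordinates in `l` are those of `y`
    have hih := ih hl' (taxiLegV U₀ x' (y, 1) μ).1
    simp only [taxiRun] at hih
    refine hih.trans (le_of_eq ?_)
    congr 1
    refine congrArg List.sum (List.map_congr_left fun ν hν => ?_)
    have hne : ν ≠ μ := fun h => hμ (h ▸ hν)
    rw [taxiLegV_fst_apply, if_neg hne]

/-- … and so is the inverse of a run. [cite: Balaban1985BackgroundPropagators, (3.3), (3.5) p.391, (3.40) p.397, (3.35)–(3.37) p.396] -/
theorem norm_taxiRun_inv_prodCfg_le (hU : ∀ μ x, ‖(U₀ μ x : 𝔸)‖ ≤ K₀) (hUi : ∀ μ x, ‖(((U₀ μ x)⁻¹ : 𝔸ˣ) : 𝔸)‖ ≤ K₀) (hRc : 0 ≤ Rc)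
    {a : Fin P.d → Site P 0 → 𝔸} (ha : a ∈ ball 0 Rc) (x' : Site P 0) (l : List (Fin P.d)) (hl : l.Nodup) :
    ∀ y : Site P 0, ‖((((taxiRun (prodCfg U₀ η a) x' l (y, 1)).2)⁻¹ : 𝔸ˣ) : 𝔸)‖ ≤
      (K₀ * Real.exp (|η| * Rc)) ^ (l.map fun μ => min (x' μ - y μ).val (y μ - x' μ).val).sum := by
  induction l with
  | nil => intro y; simp [taxiRun]
  | cons μ l ih =>
    intro y
    have hμ : μ ∉ l := (List.nodup_cons.1 hl).1
    have hl' : l.Nodup := (List.nodup_cons.1 hl).2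
    have h := taxiRun_snd_mul_and_fst_eq (prodCfg U₀ η a) U₀ x' l
    simp only [taxiRun] at h
    simp only [taxiRun, List.foldl_cons]
    rw [show taxiLegV (prodCfg U₀ η a) x' (y, 1) μ = ((taxiLegV U₀ x' (y, 1) μ).1, (taxiLegV (prodCfg U₀ η a) x' (y, 1) μ).2) from
      Prod.ext (taxiLegV_fst_eq _ _ x' y 1 1 μ) rfl, (h _ _ 1).1, mul_inv_rev, Units.val_mul, List.map_cons, List.sum_cons, add_comm, pow_add]
    have h0 : 0 ≤ K₀ * Real.exp (|η| * Rc) := (norm_nonneg _).trans ((hU (Classical.arbitrary _) (Classical.arbitrary _)).trans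
      (le_mul_of_one_le_right ((norm_nonneg _).trans (hU (Classical.arbitrary _) (Classical.arbitrary _))) (Real.one_le_exp (mul_nonneg (abs_nonneg _) hRc))))
    refine (norm_mul_le _ _).trans (mul_le_mul ?_ (norm_taxiLegV_inv_prodCfg_le U₀ η hU hUi hRc ha x' y μ) (norm_nonneg _) (pow_nonneg h0 _))
    have hih := ih hl' (taxiLegV U₀ x' (y, 1) μ).1
    simp only [taxiRun] at hih
    refine hih.trans (le_of_eq ?_)
    congr 1
    refine congrArg List.sum (List.map_congr_left fun ν hν => ?_)
    have hne : ν ≠ μ := fun h => hμ (h ▸ hν)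
    rw [taxiLegV_fst_apply, if_neg hne]

omit [NormedRing 𝔸] [NormedAlgebra ℂ 𝔸] [CompleteSpace 𝔸] [NormOneClass 𝔸] in
/-- the taxicab length as the sum over the run's legs: `Σ_{μ} min((x′_μ − x_μ).val, (x_μ − x′_μ).val) = Site.tdist x x′`.
[cite: Balaban1985BackgroundPropagators, (3.40) p.397 («a shortest contour»), dictionary] -/
theorem sum_finRange_min_eq_tdist (x x' : Site P 0) :
    ((List.finRange P.d).map fun μ => min (x' μ - x μ).val (x μ - x' μ).val).sum = Site.tdist x x' := by
  rw [Site.tdist, ← List.sum_toFinset _ (List.nodup_finRange _), List.toFinset_finRange]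
  exact Finset.sum_congr rfl fun μ _ => min_comm _ _

/-- ★★ **`‖U(Γ_{x,x′})‖ ≤ Kη^{|x − x′|₁}` ALONG THE PENCIL** on `‖A′‖ < R` (`Kη = K₀e^{|η|R}`, `|x − x′|₁ = Site.tdist x x′`: the taxicab contour has exactly
that many bonds), once `‖U₀(b)^{±1}‖ ≤ K₀`. [cite: Balaban1985BackgroundPropagators, (3.3) p.391, (3.40) p.397, (3.35)–(3.37) p.396, Thm 3.4 p.400] -/
theorem norm_parTaxiV_prodCfg_le (hU : ∀ μ x, ‖(U₀ μ x : 𝔸)‖ ≤ K₀) (hUi : ∀ μ x, ‖(((U₀ μ x)⁻¹ : 𝔸ˣ) : 𝔸)‖ ≤ K₀) (hRc : 0 ≤ Rc)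
    {a : Fin P.d → Site P 0 → 𝔸} (ha : a ∈ ball 0 Rc) (x x' : Site P 0) :
    ‖(parTaxiV (prodCfg U₀ η a) x x' : 𝔸)‖ ≤ (K₀ * Real.exp (|η| * Rc)) ^ Site.tdist x x' := by
  rw [← sum_finRange_min_eq_tdist]
  exact norm_taxiRun_prodCfg_le U₀ η hU hUi hRc ha x' _ (List.nodup_finRange _) x

/-- ★★ **`‖U(Γ_{x,x′})⁻¹‖ ≤ Kη^{|x − x′|₁}` ALONG THE PENCIL**. [cite: Balaban1985BackgroundPropagators, (3.3), (3.5) p.391, (3.40) p.397, (3.35)–(3.37) p.396] -/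
theorem norm_parTaxiV_inv_prodCfg_le (hU : ∀ μ x, ‖(U₀ μ x : 𝔸)‖ ≤ K₀) (hUi : ∀ μ x, ‖(((U₀ μ x)⁻¹ : 𝔸ˣ) : 𝔸)‖ ≤ K₀) (hRc : 0 ≤ Rc)
    {a : Fin P.d → Site P 0 → 𝔸} (ha : a ∈ ball 0 Rc) (x x' : Site P 0) :
    ‖(((parTaxiV (prodCfg U₀ η a) x x')⁻¹ : 𝔸ˣ) : 𝔸)‖ ≤ (K₀ * Real.exp (|η| * Rc)) ^ Site.tdist x x' := by
  rw [← sum_finRange_min_eq_tdist]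
  exact norm_taxiRun_inv_prodCfg_le U₀ η hU hUi hRc ha x' _ (List.nodup_finRange _) x

end Taxi

/-! ## §4. At an index: NODE 00's transporter letters of record `parBY`, `parSY` along the pencil -/

section Index

variable {d ℓ : ℕ} {hd : 1 ≤ d + 1} {hL : Odd (ℓ + 1) ∧ 1 < ℓ + 1} {b₀ b₁ : ℝ}
variable (i : KIdx d ℓ hd hL b₀ b₁) (U₀ : CfgY 𝔸 i) (η : ℝ) {Rc K₀ : ℝ}

/-- `A′ ↦ parBY i (e^{iηA′}U₀) s s′` (the bond-sector transporter letter of record) is holomorphic on every ball.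
[cite: Balaban1985BackgroundPropagators, (3.12)–(3.13) p.392, (3.14) p.393, (3.40) p.397, Thm 3.4 p.400] -/
theorem differentiableOn_parBY_prodCfg (s s' : Site (PV d ℓ i.m i.K hd hL) 0) :
    DifferentiableOn ℂ (fun a => (parBY i (prodCfg U₀ η a) s s' : 𝔸)) (ball (0 : Fin (d + 1) → Site (PV d ℓ i.m i.K hd hL) 0 → 𝔸) Rc) :=
  differentiableOn_parTaxiV_prodCfg U₀ η s s'

/-- … and its inverse. [cite: Balaban1985BackgroundPropagators, (3.13) p.392, (3.5) p.391, Thm 3.4 p.400] -/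
theorem differentiableOn_parBY_inv_prodCfg (s s' : Site (PV d ℓ i.m i.K hd hL) 0) :
    DifferentiableOn ℂ (fun a => (((parBY i (prodCfg U₀ η a) s s')⁻¹ : 𝔸ˣ) : 𝔸))
      (ball (0 : Fin (d + 1) → Site (PV d ℓ i.m i.K hd hL) 0 → 𝔸) Rc) :=
  differentiableOn_parTaxiV_inv_prodCfg U₀ η s s'

/-- `A′ ↦ parSY i (e^{iηA′}U₀) z z′` (the site-sector transporter letter of record, through the box chart) is holomorphic on every ball.
[cite: Balaban1985BackgroundPropagators, (3.19), (3.21) pp.393–394, (3.40) p.397, Thm 3.4 p.400] -/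
theorem differentiableOn_parSY_prodCfg (z z' : SiteY i) :
    DifferentiableOn ℂ (fun a => (parSY i (prodCfg U₀ η a) z z' : 𝔸)) (ball (0 : Fin (d + 1) → Site (PV d ℓ i.m i.K hd hL) 0 → 𝔸) Rc) :=
  differentiableOn_parTaxiV_prodCfg U₀ η _ _

/-- … and its inverse. [cite: Balaban1985BackgroundPropagators, (3.21) p.394, (3.5) p.391, Thm 3.4 p.400] -/
theorem differentiableOn_parSY_inv_prodCfg (z z' : SiteY i) :
    DifferentiableOn ℂ (fun a => (((parSY i (prodCfg U₀ η a) z z')⁻¹ : 𝔸ˣ) : 𝔸))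
      (ball (0 : Fin (d + 1) → Site (PV d ℓ i.m i.K hd hL) 0 → 𝔸) Rc) :=
  differentiableOn_parTaxiV_inv_prodCfg U₀ η _ _

variable [NormOneClass 𝔸]

/-- On `‖A′‖ < R`: `‖parBY i (e^{iηA′}U₀) s s′‖ ≤ Kη^{Site.tdist s s′}`. [cite: Balaban1985BackgroundPropagators, (3.12)–(3.13) p.392, (3.14) p.393, (3.40) p.397, (3.35)–(3.37) p.396] -/
theorem norm_parBY_prodCfg_le (hU : ∀ μ x, ‖(U₀ μ x : 𝔸)‖ ≤ K₀) (hUi : ∀ μ x, ‖(((U₀ μ x)⁻¹ : 𝔸ˣ) : 𝔸)‖ ≤ K₀) (hRc : 0 ≤ Rc)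
    {a : Fin (d + 1) → Site (PV d ℓ i.m i.K hd hL) 0 → 𝔸} (ha : a ∈ ball 0 Rc) (s s' : Site (PV d ℓ i.m i.K hd hL) 0) :
    ‖(parBY i (prodCfg U₀ η a) s s' : 𝔸)‖ ≤ (K₀ * Real.exp (|η| * Rc)) ^ Site.tdist s s' :=
  norm_parTaxiV_prodCfg_le U₀ η hU hUi hRc ha s s'

/-- On `‖A′‖ < R`: `‖(parBY i (e^{iηA′}U₀) s s′)⁻¹‖ ≤ Kη^{Site.tdist s s′}`. [cite: Balaban1985BackgroundPropagators, (3.13) p.392, (3.5) p.391, (3.35)–(3.37) p.396] -/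
theorem norm_parBY_inv_prodCfg_le (hU : ∀ μ x, ‖(U₀ μ x : 𝔸)‖ ≤ K₀) (hUi : ∀ μ x, ‖(((U₀ μ x)⁻¹ : 𝔸ˣ) : 𝔸)‖ ≤ K₀) (hRc : 0 ≤ Rc)
    {a : Fin (d + 1) → Site (PV d ℓ i.m i.K hd hL) 0 → 𝔸} (ha : a ∈ ball 0 Rc) (s s' : Site (PV d ℓ i.m i.K hd hL) 0) :
    ‖(((parBY i (prodCfg U₀ η a) s s')⁻¹ : 𝔸ˣ) : 𝔸)‖ ≤ (K₀ * Real.exp (|η| * Rc)) ^ Site.tdist s s' :=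
  norm_parTaxiV_inv_prodCfg_le U₀ η hU hUi hRc ha s s'

/-- On `‖A′‖ < R`: `‖parSY i (e^{iηA′}U₀) z z′‖ ≤ Kη^{Site.tdist (chart⁻¹ z) (chart⁻¹ z′)}`.
[cite: Balaban1985BackgroundPropagators, (3.19), (3.21) pp.393–394, (3.40) p.397, (3.35)–(3.37) p.396] -/
theorem norm_parSY_prodCfg_le (hU : ∀ μ x, ‖(U₀ μ x : 𝔸)‖ ≤ K₀) (hUi : ∀ μ x, ‖(((U₀ μ x)⁻¹ : 𝔸ˣ) : 𝔸)‖ ≤ K₀) (hRc : 0 ≤ Rc)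
    {a : Fin (d + 1) → Site (PV d ℓ i.m i.K hd hL) 0 → 𝔸} (ha : a ∈ ball 0 Rc) (z z' : SiteY i) :
    ‖(parSY i (prodCfg U₀ η a) z z' : 𝔸)‖ ≤ (K₀ * Real.exp (|η| * Rc)) ^ Site.tdist ((boxEquiv i.hN).symm z) ((boxEquiv i.hN).symm z') :=
  norm_parTaxiV_prodCfg_le U₀ η hU hUi hRc ha _ _

/-- On `‖A′‖ < R`: `‖(parSY i (e^{iηA′}U₀) z z′)⁻¹‖ ≤ Kη^{Site.tdist (chart⁻¹ z) (chart⁻¹ z′)}`.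
[cite: Balaban1985BackgroundPropagators, (3.21) p.394, (3.5) p.391, (3.35)–(3.37) p.396] -/
theorem norm_parSY_inv_prodCfg_le (hU : ∀ μ x, ‖(U₀ μ x : 𝔸)‖ ≤ K₀) (hUi : ∀ μ x, ‖(((U₀ μ x)⁻¹ : 𝔸ˣ) : 𝔸)‖ ≤ K₀) (hRc : 0 ≤ Rc)
    {a : Fin (d + 1) → Site (PV d ℓ i.m i.K hd hL) 0 → 𝔸} (ha : a ∈ ball 0 Rc) (z z' : SiteY i) :
    ‖(((parSY i (prodCfg U₀ η a) z z')⁻¹ : 𝔸ˣ) : 𝔸)‖ ≤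
      (K₀ * Real.exp (|η| * Rc)) ^ Site.tdist ((boxEquiv i.hN).symm z) ((boxEquiv i.hN).symm z') :=
  norm_parTaxiV_inv_prodCfg_le U₀ η hU hUi hRc ha _ _

end Index

end Literature.MathematicalPhysics.QuantumFieldTheory.Balaban1983to89.B13OpsYPencilTransport

end
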